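import Summits.QuantumFields.YangMills.Theorems.LuscherReductionDressedRitzPolyakovLiftMultipletRecombination
import HarnessLib

/-!
# Line «polyakovlift» on crux `DressedRitz` (stmt-QuantumFields-20205), stubs S-STAT ∕ S-POS: a SYMMETRIC MULTIPLET certified by one-site data alone —
# pairwise involution separation + transitive symmetries ⟹ scalar Gram and coupling blocks ⟹ (o2), (o6) exact for EVERY basis of its span

Fleet-service module of seat ym-infvol-p1 g6 (route `LuscherReduction`, femto rung R2b1; bears on the crux child `DressedRitz` = stmt-QuantumFields-20205,
skeleton r5 `8b6782afbcc2a19a`).  `…PolyakovLiftMultipletRecombination.lean` (p542214) proves (o2)∕(o6) for every orthogonal recombination of a family `f`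
with SCALAR dressed Gram and coupling blocks — hypotheses on the FINE numbers.  This module derives those hypotheses from ONE-SITE SYMMETRY DATA of `f`
only, so that the certificate for a whole multiplet (e.g. a `T`-triplet of the hyperoctahedral group, or an `E`-doublet) is checkable in the one-site model:

* `l2_dressed_pair_eq_zero_of_involution` — an involutive symmetry `σ` of the two-time forms with `f ∘ σ = f`, `h ∘ σ = −h` gives `N(f,h) = 0 = D(f,h) = D(h,f)`;
* ★ `scalarBlock_of_symmetries` — if the members of `f : Fin n → (one-site functions)` are PAIRWISE separated by involutive symmetries (`f_a` even, `f_b` odd under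
  some `σ_ab`) and TRANSITIVELY related to a base member (`f_{a₀} ∘ τ_a = ε_a f_a`, `ε_a² = 1`, `τ_a` a symmetry), then `N(f_a,f_b) = c·δ_ab`, `D(f_a,f_b) = d·δ_ab`
  with `c = N(f_{a₀},f_{a₀})`, `d = D(f_{a₀},f_{a₀})`;
* ★★ `dressedLiftFamily_o2_o6_of_symmetricMultiplet` — hence clause (o2) of S-STAT and clause (o6) of S-POS hold with ANY `C ≥ 0` for every pair of
  orthogonal recombinations `g_i = Σ pₐfₐ`, `g_l = Σ qₐfₐ` (`Σ pₐqₐ = 0`) of such a multiplet, for every raw vacuum.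
  Example (axis-adapted `T₂⁺`-type triplet, members transforming like `x₁x₂, x₂x₀, x₀x₁`): `σ_ab` = the reflection `R_c` of an axis `c` occurring in
  `f_b` but not in `f_a` (`f_a` even, `f_b` odd), `τ_a` = an axis transposition; all are symmetries of the forms (`…ParitySymmetry.lean`, seat g5's `S₃`).

HONEST FRAMING: fixed-lattice symmetry∕bilinear bookkeeping on the conditional femto rung R2b1; no renormalisation-group content; nothing here bears on
infinite volume, the continuum limit or the Clay gap.  References: M. Lüscher, NPB 219 (1983) 233, §2 [cite: Luscher1983, §2]; M. Lüscher, U. Wolff, NPB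
339 (1990) 222 [cite: LuscherWolff1990].
-/

set_option autoImplicit false

noncomputable section

open MeasureTheory Filter Topology Real
open Literature.MathematicalPhysics.QuantumFieldTheory
open scoped BigOperators

namespace Summit.QuantumFields.YangMills.Theorems.FemtoTransferGap.PolyakovLift

open Summit.QuantumFields.YangMills.Theorems.FemtoTransferGap

section Multiplet

variable {L : ℕ} [NeZero L] {n : ℕ}

/-- **Involution zero, number form**: an involutive one-site map `σ` preserving physicality and the two-time forms at flow time `L²/√λ`, with `f` even and
`h` odd, gives `⟨u'_f, u'_h⟩ = 0`, `⟨u'_f, K_β u'_h⟩ = 0`, `⟨u'_h, K_β u'_f⟩ = 0` (twirl over `{id, σ}`, weights `½`). [cite: Luscher1983, §2] -/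
theorem l2_dressed_pair_eq_zero_of_involution (β : ℝ) {φ : GaugeConfig 3 L SU2 → ℝ} (hφ : IsPhys φ)
    (σ : GaugeConfig 3 1 SU2 → GaugeConfig 3 1 SU2) (hσ : ∀ V, σ (σ V) = V)
    (hσphys : ∀ F : GaugeConfig 3 1 SU2 → ℝ, IsPhys F → IsPhys fun V => F (σ V))
    (hσinv : ∀ (F H : GaugeConfig 3 1 SU2 → ℝ) (a b : ℕ),
      l2 ((transferApply β)^[a] (OpPlat.ins φ (flowLiftAt (L := L) 0 (flowTime β L) fun V => F (σ V))))
          ((transferApply β)^[b] (OpPlat.ins φ (flowLiftAt 0 (flowTime β L) fun V => H (σ V)))) =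
        l2 ((transferApply β)^[a] (OpPlat.ins φ (flowLiftAt (L := L) 0 (flowTime β L) F)))
          ((transferApply β)^[b] (OpPlat.ins φ (flowLiftAt 0 (flowTime β L) H))))
    {f h : GaugeConfig 3 1 SU2 → ℝ} (hf : IsPhys f) (hh : IsPhys h)
    (heven : ∀ V, f (σ V) = f V) (hodd : ∀ V, h (σ V) = -h V) :
    l2 (dressedLiftVec β φ f) (dressedLiftVec β φ h) = 0 ∧
      l2 (dressedLiftVec β φ f) (transferApply β (dressedLiftVec β φ h)) = 0 ∧
      l2 (dressedLiftVec β φ h) (transferApply β (dressedLiftVec β φ f)) = 0 := by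
  let γ : Bool → GaugeConfig 3 1 SU2 → GaugeConfig 3 1 SU2 := fun c V => bif c then σ V else V
  have hγ : ∀ c V, γ c (γ c V) = V := fun c V => by
    cases c
    · rfl
    · simp only [γ, cond_true, hσ]
  have hphys : ∀ c (F : GaugeConfig 3 1 SU2 → ℝ), IsPhys F → IsPhys fun V => F (γ c V) := fun c F hF => by
    cases c
    · exact hF
    · exact hσphys F hF
  have hinv : ∀ c (F H : GaugeConfig 3 1 SU2 → ℝ), IsPhys F → IsPhys H → ∀ a b : ℕ,
      l2 ((transferApply β)^[a] (OpPlat.ins φ (flowLiftAt (L := L) 0 (flowTime β L) fun V => F (γ c V))))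
          ((transferApply β)^[b] (OpPlat.ins φ (flowLiftAt 0 (flowTime β L) fun V => H (γ c V)))) =
        l2 ((transferApply β)^[a] (OpPlat.ins φ (flowLiftAt (L := L) 0 (flowTime β L) F)))
          ((transferApply β)^[b] (OpPlat.ins φ (flowLiftAt 0 (flowTime β L) H))) := fun c F H _ _ a b => by
    cases c
    · rfl
    · exact hσinv F H a b
  -- the pair `(f, h)` as a `Fin 2`-family
  let g : Fin 2 → (GaugeConfig 3 1 SU2 → ℝ) := ![f, h]
  have hg : ∀ j, IsPhys (g j) := fun j => by fin_cases j <;> assumption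
  have hfix : ∀ V, ∑ c : Bool, (1 / 2 : ℝ) * g 0 (γ c V) = g 0 V := fun V => by
    show ∑ c : Bool, (1 / 2 : ℝ) * f (γ c V) = f V
    simp only [γ, Fintype.sum_bool, cond_true, cond_false, heven]; ring
  have hann : ∀ V, ∑ c : Bool, (1 / 2 : ℝ) * g 1 (γ c V) = 0 := fun V => by
    show ∑ c : Bool, (1 / 2 : ℝ) * h (γ c V) = 0
    simp only [γ, Fintype.sum_bool, cond_true, cond_false, hodd]; ring
  exact l2_dressed_pair_eq_zero_of_twirl β hφ γ (Equiv.refl Bool) (fun c V => hγ c V) hphys hinv (fun _ => (1 / 2 : ℝ)) (fun _ => rfl)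
    hg 0 1 hfix hann

/-- ★ **Scalar blocks from one-site symmetry data.**  Let `f : Fin n → (one-site functions)` be physical, with
(i) for every `a ≠ b` an involutive symmetry `σ a b` of the two-time forms under which `f_a` is even and `f_b` is odd, and
(ii) for every `a` a symmetry `τ a` of the two-time forms carrying the base member to `±f_a`: `f_{a₀} (τ a V) = ε_a · f_a V`, `ε_a² = 1`.
Then the dressed Gram and coupling blocks of `f` are SCALAR: `N(f_a,f_b) = c·δ_ab`, `D(f_a,f_b) = d·δ_ab`, `c = N(f_{a₀},f_{a₀})`, `d = D(f_{a₀},f_{a₀})`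
(raw vacuum `φ`). [cite: Luscher1983, §2] -/
theorem scalarBlock_of_symmetries (β : ℝ) {φ : GaugeConfig 3 L SU2 → ℝ} (hφ : IsPhys φ)
    {f : Fin n → (GaugeConfig 3 1 SU2 → ℝ)} (hf : ∀ a, IsPhys (f a)) (a₀ : Fin n)
    (σ : Fin n → Fin n → GaugeConfig 3 1 SU2 → GaugeConfig 3 1 SU2)
    (hσ : ∀ a b, a ≠ b →
      (∀ V, σ a b (σ a b V) = V) ∧ (∀ F : GaugeConfig 3 1 SU2 → ℝ, IsPhys F → IsPhys fun V => F (σ a b V)) ∧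
      (∀ (F H : GaugeConfig 3 1 SU2 → ℝ) (s t : ℕ),
        l2 ((transferApply β)^[s] (OpPlat.ins φ (flowLiftAt (L := L) 0 (flowTime β L) fun V => F (σ a b V))))
            ((transferApply β)^[t] (OpPlat.ins φ (flowLiftAt 0 (flowTime β L) fun V => H (σ a b V)))) =
          l2 ((transferApply β)^[s] (OpPlat.ins φ (flowLiftAt (L := L) 0 (flowTime β L) F)))
            ((transferApply β)^[t] (OpPlat.ins φ (flowLiftAt 0 (flowTime β L) H)))) ∧
      (∀ V, f a (σ a b V) = f a V) ∧ (∀ V, f b (σ a b V) = -f b V))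
    (τ : Fin n → GaugeConfig 3 1 SU2 → GaugeConfig 3 1 SU2)
    (hτ : ∀ a,
      (∀ (F H : GaugeConfig 3 1 SU2 → ℝ) (s t : ℕ),
        l2 ((transferApply β)^[s] (OpPlat.ins φ (flowLiftAt (L := L) 0 (flowTime β L) fun V => F (τ a V))))
            ((transferApply β)^[t] (OpPlat.ins φ (flowLiftAt 0 (flowTime β L) fun V => H (τ a V)))) =
          l2 ((transferApply β)^[s] (OpPlat.ins φ (flowLiftAt (L := L) 0 (flowTime β L) F)))
            ((transferApply β)^[t] (OpPlat.ins φ (flowLiftAt 0 (flowTime β L) H)))) ∧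
      ∃ ε : ℝ, ε ^ 2 = 1 ∧ ∀ V, f a₀ (τ a V) = ε * f a V) :
    (∀ a b, l2 (dressedLiftVec β φ (f a)) (dressedLiftVec β φ (f b)) =
        if a = b then l2 (dressedLiftVec β φ (f a₀)) (dressedLiftVec β φ (f a₀)) else 0) ∧
      (∀ a b, l2 (dressedLiftVec β φ (f a)) (transferApply β (dressedLiftVec β φ (f b))) =
        if a = b then l2 (dressedLiftVec β φ (f a₀)) (transferApply β (dressedLiftVec β φ (f a₀))) else 0) := by
  -- diagonal entries: transitivity
  have hdiag : ∀ a, l2 (dressedLiftVec β φ (f a)) (dressedLiftVec β φ (f a)) = l2 (dressedLiftVec β φ (f a₀)) (dressedLiftVec β φ (f a₀)) ∧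
      l2 (dressedLiftVec β φ (f a)) (transferApply β (dressedLiftVec β φ (f a))) =
        l2 (dressedLiftVec β φ (f a₀)) (transferApply β (dressedLiftVec β φ (f a₀))) := fun a => by
    obtain ⟨hinv, ε, hε, hmap⟩ := hτ a
    obtain ⟨hN, hD⟩ := l2_dressed_diag_eq_of_symmetry β hφ (τ a) hinv (hf a) hε hmap
    exact ⟨hN.symm, hD.symm⟩
  -- off-diagonal entries: involution zeros
  have hoff : ∀ a b, a ≠ b → l2 (dressedLiftVec β φ (f a)) (dressedLiftVec β φ (f b)) = 0 ∧
      l2 (dressedLiftVec β φ (f a)) (transferApply β (dressedLiftVec β φ (f b))) = 0 := fun a b hab => by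
    obtain ⟨hs, hsphys, hsinv, heven, hodd⟩ := hσ a b hab
    obtain ⟨h0, h1, -⟩ := l2_dressed_pair_eq_zero_of_involution β hφ (σ a b) hs hsphys hsinv (hf a) (hf b) heven hodd
    exact ⟨h0, h1⟩
  refine ⟨fun a b => ?_, fun a b => ?_⟩
  · by_cases hab : a = b
    · subst hab; rw [if_pos rfl]; exact (hdiag a).1
    · rw [if_neg hab]; exact (hoff a b hab).1
  · by_cases hab : a = b
    · subst hab; rw [if_pos rfl]; exact (hdiag a).2
    · rw [if_neg hab]; exact (hoff a b hab).2

/-- ★★ **(o2) and (o6) for EVERY basis of a symmetric multiplet, from one-site data.**  Under the hypotheses of `scalarBlock_of_symmetries` on a physical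
family `f` (pairwise involution separation, transitive symmetries), every pair of orthogonal recombinations `g_i = Σ pₐfₐ`, `g_l = Σ qₐfₐ` (`Σ pₐqₐ = 0`) of
channels of a lift basis satisfies clause (o2) of `StaticClauses` (S-STAT) and clause (o6) of `DynamicCoreClauses` (S-POS) with ANY `C ≥ 0`, for every raw
vacuum (`dressedLiftFamily_o2_o6_of_scalarBlock`). [cite: Luscher1983, §2] [cite: LuscherWolff1990] -/
theorem dressedLiftFamily_o2_o6_of_symmetricMultiplet (β : ℝ) {φ : GaugeConfig 3 L SU2 → ℝ} (hvac : IsRawVacuum β φ)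
    {f : Fin n → (GaugeConfig 3 1 SU2 → ℝ)} (hf : ∀ a, IsPhys (f a)) (a₀ : Fin n)
    (σ : Fin n → Fin n → GaugeConfig 3 1 SU2 → GaugeConfig 3 1 SU2)
    (hσ : ∀ a b, a ≠ b →
      (∀ V, σ a b (σ a b V) = V) ∧ (∀ F : GaugeConfig 3 1 SU2 → ℝ, IsPhys F → IsPhys fun V => F (σ a b V)) ∧
      (∀ (F H : GaugeConfig 3 1 SU2 → ℝ) (s t : ℕ),
        l2 ((transferApply β)^[s] (OpPlat.ins φ (flowLiftAt (L := L) 0 (flowTime β L) fun V => F (σ a b V))))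
            ((transferApply β)^[t] (OpPlat.ins φ (flowLiftAt 0 (flowTime β L) fun V => H (σ a b V)))) =
          l2 ((transferApply β)^[s] (OpPlat.ins φ (flowLiftAt (L := L) 0 (flowTime β L) F)))
            ((transferApply β)^[t] (OpPlat.ins φ (flowLiftAt 0 (flowTime β L) H)))) ∧
      (∀ V, f a (σ a b V) = f a V) ∧ (∀ V, f b (σ a b V) = -f b V))
    (τ : Fin n → GaugeConfig 3 1 SU2 → GaugeConfig 3 1 SU2)
    (hτ : ∀ a,
      (∀ (F H : GaugeConfig 3 1 SU2 → ℝ) (s t : ℕ),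
        l2 ((transferApply β)^[s] (OpPlat.ins φ (flowLiftAt (L := L) 0 (flowTime β L) fun V => F (τ a V))))
            ((transferApply β)^[t] (OpPlat.ins φ (flowLiftAt 0 (flowTime β L) fun V => H (τ a V)))) =
          l2 ((transferApply β)^[s] (OpPlat.ins φ (flowLiftAt (L := L) 0 (flowTime β L) F)))
            ((transferApply β)^[t] (OpPlat.ins φ (flowLiftAt 0 (flowTime β L) H)))) ∧
      ∃ ε : ℝ, ε ^ 2 = 1 ∧ ∀ V, f a₀ (τ a V) = ε * f a V)
    {B : ℝ} {k : ℕ} {ω : GaugeConfig 3 1 SU2 → ℝ} {g : Fin k → (GaugeConfig 3 1 SU2 → ℝ)} (hbasis : LiftBasis B k ω g)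
    {C : ℝ} (hC : 0 ≤ C) (i l : Fin k) (p q : Fin n → ℝ) (hpq : ∑ a, p a * q a = 0)
    (hgi : ∀ V, g i V = ∑ a, p a * f a V) (hgl : ∀ V, g l V = ∑ a, q a * f a V) :
    |l2 (dressedLiftFamily β φ g i) (dressedLiftFamily β φ g l)| ≤
        C * luscherLambda β L *
          (Real.sqrt (l2 (dressedLiftFamily β φ g i) (dressedLiftFamily β φ g i)) *
            Real.sqrt (l2 (dressedLiftFamily β φ g l) (dressedLiftFamily β φ g l))) ∧
      |l2 (dressedLiftFamily β φ g i) (transferApply β (dressedLiftFamily β φ g l)) -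
          (l2 (dressedLiftFamily β φ g i) (transferApply β (dressedLiftFamily β φ g i)) /
                l2 (dressedLiftFamily β φ g i) (dressedLiftFamily β φ g i) +
              l2 (dressedLiftFamily β φ g l) (transferApply β (dressedLiftFamily β φ g l)) /
                l2 (dressedLiftFamily β φ g l) (dressedLiftFamily β φ g l)) / 2 *
            l2 (dressedLiftFamily β φ g i) (dressedLiftFamily β φ g l)|
        ≤ C * (luscherLambda β L ^ 2 / L) * levelValue su2Rep L β 0 *
            (Real.sqrt (l2 (dressedLiftFamily β φ g i) (dressedLiftFamily β φ g i)) *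
              Real.sqrt (l2 (dressedLiftFamily β φ g l) (dressedLiftFamily β φ g l))) := by
  obtain ⟨hN, hD⟩ := scalarBlock_of_symmetries β hvac.1 hf a₀ σ hσ τ hτ
  exact dressedLiftFamily_o2_o6_of_scalarBlock β hvac hf hN hD hbasis hC i l p q hpq hgi hgl

end Multiplet

end Summit.QuantumFields.YangMills.Theorems.FemtoTransferGap.PolyakovLift

end
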